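import Summits.ABC.ABC.Theses.CongruentialReceptacle
import Summits.ABC.ABC.Theorems.CongruentialReceptacleQuarterWindowGivesCrux
import HarnessLib

/-!
# Crux stmt-ABC-1725 `CompactBalanceTransfer` — ideator 5, round 2: checkable framing facts

`CompactBalanceTransfer := H → ABC`, `H` = abc (1+ε) on every compactly balanced cell.

This scratch file records, kernel-checked, the two logical facts behind the round-2 obstruction note
`Obstructions-r2-k5.md`:

* `complement_iff` — a line on the crux is exactly a statement `S` with `S ∧ H → ABC`
  (a "complement of `H` relative to the summit"); the triage rule "H used, stubs < ABC" asks for a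
  complement that is not itself `≥ ABC`.
* `abc_of_deepCellABC` / `deepCellABC_iff_abc` — the complement BY DEPTH is already the summit:
  abc on the single deep cell `4b ≤ c` (no balance hypothesis at all on the other side) implies abc for
  every triple, by ONE squaring split `(a, b, c) ↦ (a(a+2b), b², c²)` resp. its swap, whose small member
  `min(a,b)²` is always `≤ c²/4` and whose radical is `≤ 2c · rad(abc)` (tree lemmas `split_isABCTriple`,
  `rad_split_le`). Hence "deepening is free, balancing is the whole content": no decomposition of the
  crux by depth regimes has a piece strictly below the summit (census D3 made formal), and every
  sub-family complement that contains the image of a cusp-preserving identity collapses to ABC.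

Elementary; standard axioms; no named facts.
-/

set_option linter.dupNamespace false
set_option linter.unusedVariables false

namespace Summit.ABC.ABC.Cruxes.CompactBalanceTransfer.Ideator5

open Literature.NumberTheory.DiophantineGeometry
open Summit.ABC.ABC.Theses.CongruentialReceptacle
open Summit.ABC.ABC.Theorems

/-- `H`: abc with exponent `1+ε` on every compactly balanced cell (the hypothesis of the crux). -/
def BalancedABC : Prop :=
  ∀ κ : ℝ, 0 < κ → ∀ ε : ℝ, 0 < ε → ∃ C : ℝ, ∀ a b c : ℕ, IsABCTriple a b c →
    κ * (c : ℝ) ≤ (a : ℝ) → κ * (c : ℝ) ≤ (b : ℝ) → (c : ℝ) < C * ((rad a b c : ℕ) : ℝ) ^ (1 + ε)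

theorem crux_iff : CompactBalanceTransfer ↔ (BalancedABC → _root_.ABC) := Iff.rfl

/-- **Complement principle.** A statement `S` closes the crux iff `S ∧ H` proves the summit. -/
theorem complement_iff (S : Prop) :
    (S → CompactBalanceTransfer) ↔ (S ∧ BalancedABC → _root_.ABC) :=
  ⟨fun h ⟨hS, hH⟩ => h hS hH, fun h hS hH => h ⟨hS, hH⟩⟩

/-- abc with exponent `1+ε` on the single DEEP cell `4b ≤ c` (second member at most a quarter of the
sum; no hypothesis whatsoever on balanced triples). -/
def DeepCellABC : Prop :=
  ∀ ε : ℝ, 0 < ε → ∃ C : ℝ, ∀ a b c : ℕ, IsABCTriple a b c →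
    4 * (b : ℝ) ≤ (c : ℝ) → (c : ℝ) < C * ((rad a b c : ℕ) : ℝ) ^ (1 + ε)

/-- The summit implies abc on the deep cell (discard the hypothesis). -/
theorem deepCellABC_of_abc (h : _root_.ABC) : DeepCellABC := by
  intro ε hε
  obtain ⟨C, _, hC⟩ := (ABC_iff.mp h) ε hε
  exact ⟨C, fun a b c habc _ => hC a b c habc⟩

/-- Core step: if abc holds on the deep cell with exponent `1+ε'` and constant `C'`, then for an abc
triple `(a, b, c)` with `b ≤ a` the squaring split `(a(a+2b), b², c²)` lies in the deep cell
(`4b² ≤ c²` from `2b ≤ c`), so `2 log c < log(max C' 1) + (1+ε')(log 2 + log c + log rad(abc))`. -/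
theorem log_bound_of_deep {ε' C' : ℝ} (hε' : 0 < ε') (hε'1 : ε' < 1)
    (H : ∀ a b c : ℕ, IsABCTriple a b c → 4 * (b : ℝ) ≤ (c : ℝ) →
      (c : ℝ) < C' * ((rad a b c : ℕ) : ℝ) ^ (1 + ε'))
    {a b c : ℕ} (h : IsABCTriple a b c) (hba : b ≤ a) :
    Real.log (c : ℝ) < (Real.log (max C' 1) + (1 + ε') * Real.log 2) / (1 - ε')
      + (1 + ε') / (1 - ε') * Real.log ((rad a b c : ℕ) : ℝ) := by
  obtain ⟨ha0, hb0, habc, hcop⟩ := h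
  have hT : IsABCTriple (a * (a + 2 * b)) (b ^ 2) (c ^ 2) := split_isABCTriple ⟨ha0, hb0, habc, hcop⟩
  have hc0' : c ≠ 0 := by omega
  have haR : (0 : ℝ) < a := by exact_mod_cast ha0
  have hbR : (0 : ℝ) < b := by exact_mod_cast hb0
  have hbaR : (b : ℝ) ≤ a := by exact_mod_cast hba
  have hcR : (c : ℝ) = a + b := by exact_mod_cast habc.symm
  have hcpos : (0 : ℝ) < c := by rw [hcR]; exact add_pos haR hbR
  -- the split lies in the deep cell: 4 b² ≤ c²
  have hdeep : 4 * ((b ^ 2 : ℕ) : ℝ) ≤ ((c ^ 2 : ℕ) : ℝ) := by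
    push_cast
    nlinarith
  have hmain := H _ _ _ hT hdeep
  -- radicals
  have hr0 : 0 < rad a b c := Nat.radical_pos _
  have hrpos : (0 : ℝ) < ((rad a b c : ℕ) : ℝ) := by exact_mod_cast hr0
  have hrS0 : 0 < rad (a * (a + 2 * b)) (b ^ 2) (c ^ 2) := Nat.radical_pos _
  have hrSpos : (0 : ℝ) < ((rad (a * (a + 2 * b)) (b ^ 2) (c ^ 2) : ℕ) : ℝ) := by exact_mod_cast hrS0
  have hradle : ((rad (a * (a + 2 * b)) (b ^ 2) (c ^ 2) : ℕ) : ℝ) ≤ 2 * c * ((rad a b c : ℕ) : ℝ) := by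
    have h1 : rad (a * (a + 2 * b)) (b ^ 2) (c ^ 2) ≤ (a + 2 * b) * rad a b c :=
      rad_split_le ha0.ne' hb0.ne' hc0'
    have h2 : ((rad (a * (a + 2 * b)) (b ^ 2) (c ^ 2) : ℕ) : ℝ)
        ≤ ((a + 2 * b : ℕ) : ℝ) * ((rad a b c : ℕ) : ℝ) := by exact_mod_cast h1
    have h3 : ((a + 2 * b : ℕ) : ℝ) ≤ 2 * c := by push_cast; linarith
    exact h2.trans (mul_le_mul_of_nonneg_right h3 hrpos.le)
  -- replace C' by M = max C' 1 > 0
  set M : ℝ := max C' 1 with hM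
  have hMpos : 0 < M := lt_of_lt_of_le one_pos (le_max_right _ _)
  have hXpos : 0 < ((rad (a * (a + 2 * b)) (b ^ 2) (c ^ 2) : ℕ) : ℝ) ^ (1 + ε') :=
    Real.rpow_pos_of_pos hrSpos _
  have hmain' : ((c ^ 2 : ℕ) : ℝ) < M * ((rad (a * (a + 2 * b)) (b ^ 2) (c ^ 2) : ℕ) : ℝ) ^ (1 + ε') :=
    lt_of_lt_of_le hmain (mul_le_mul_of_nonneg_right (le_max_left _ _) hXpos.le)
  have hc2pos : (0 : ℝ) < ((c ^ 2 : ℕ) : ℝ) := by positivity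
  have hlog := Real.log_lt_log hc2pos hmain'
  rw [Real.log_mul hMpos.ne' hXpos.ne', Real.log_rpow hrSpos] at hlog
  have hlogS : Real.log ((rad (a * (a + 2 * b)) (b ^ 2) (c ^ 2) : ℕ) : ℝ)
      ≤ Real.log 2 + Real.log c + Real.log ((rad a b c : ℕ) : ℝ) := by
    have h := Real.log_le_log hrSpos hradle
    rwa [Real.log_mul (by positivity) hrpos.ne', Real.log_mul (by norm_num) hcpos.ne'] at h
  have hlogc2 : Real.log ((c ^ 2 : ℕ) : ℝ) = 2 * Real.log c := by
    push_cast
    rw [Real.log_pow]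
    norm_num
  rw [hlogc2] at hlog
  have h1ε : 0 < 1 - ε' := by linarith
  have hε1 : 0 ≤ 1 + ε' := by linarith
  have hkey := mul_le_mul_of_nonneg_left hlogS hε1
  rw [div_mul_eq_mul_div, ← add_div, lt_div_iff₀ h1ε]
  linarith

/-- **Depth is free.** abc on the deep cell `4b ≤ c` implies abc for ALL triples: with
`ε' = ε/(2+ε)` (so `(1+ε')/(1−ε') = 1+ε`) split the triple (or its swap) once. -/
theorem abc_of_deepCellABC (hD : DeepCellABC) : _root_.ABC := by
  rw [ABC_iff]
  intro ε hε
  have h2ε : (2 : ℝ) + ε ≠ 0 := by positivity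
  have hε' : 0 < ε / (2 + ε) := by positivity
  have hε'1 : ε / (2 + ε) < 1 := by
    rw [div_lt_one (by positivity)]
    linarith
  have h1m : 0 < 1 - ε / (2 + ε) := by linarith
  have hratio : (1 + ε / (2 + ε)) / (1 - ε / (2 + ε)) = 1 + ε := by
    rw [div_eq_iff h1m.ne']
    field_simp
    ring
  obtain ⟨C', hC'⟩ := hD (ε / (2 + ε)) hε'
  set K : ℝ := (Real.log (max C' 1) + (1 + ε / (2 + ε)) * Real.log 2) / (1 - ε / (2 + ε)) with hK
  refine ⟨Real.exp K, Real.exp_pos K, ?_⟩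
  intro a b c h
  have hr0 : 0 < rad a b c := Nat.radical_pos _
  have hrpos : (0 : ℝ) < ((rad a b c : ℕ) : ℝ) := by exact_mod_cast hr0
  have hcpos : (0 : ℝ) < c := by
    obtain ⟨ha0, -, habc, -⟩ := h
    have h0 : 0 < c := by omega
    exact_mod_cast h0
  -- logarithmic bound, by cases on which member is smaller
  have hlog : Real.log (c : ℝ) < K + (1 + ε) * Real.log ((rad a b c : ℕ) : ℝ) := by
    rcases le_total b a with hba | hab
    · have hcore := log_bound_of_deep hε' hε'1 hC' h hba
      rw [hratio] at hcore
      exact hcore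
    · have hcore := log_bound_of_deep hε' hε'1 hC' h.swap hab
      rw [rad_swap a b c, hratio] at hcore
      exact hcore
  calc (c : ℝ) = Real.exp (Real.log c) := (Real.exp_log hcpos).symm
    _ < Real.exp (K + (1 + ε) * Real.log ((rad a b c : ℕ) : ℝ)) := Real.exp_lt_exp.mpr hlog
    _ = Real.exp K * ((rad a b c : ℕ) : ℝ) ^ (1 + ε) := by
        rw [Real.exp_add, Real.rpow_def_of_pos hrpos, mul_comm (Real.log _)]

/-- **The complement by depth is the summit.** -/
theorem deepCellABC_iff_abc : DeepCellABC ↔ _root_.ABC :=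
  ⟨abc_of_deepCellABC, deepCellABC_of_abc⟩

/-- Consequently a line whose only deep-side stub is "abc on the deep cell" is a dissolution: that
stub alone is the summit, and the balanced hypothesis `H` is not needed. -/
theorem crux_of_deepCellABC (hD : DeepCellABC) : CompactBalanceTransfer :=
  fun _ => abc_of_deepCellABC hD

end Summit.ABC.ABC.Cruxes.CompactBalanceTransfer.Ideator5
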